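import Mathlib.LinearAlgebra.Matrix.NonsingularInverse
import Mathlib.Analysis.SpecialFunctions.Exp
import Mathlib.Order.Interval.Set.Basic
import HarnessLib

/-!
# S2β · LINE g18-1 · DET-REP-B — PRODUCT-ROWS TIGHTNESS: what the (LOC) letters force on the NAMED slice Hessians, scale-free

Cell `ym3-torus` (rung R3: continuum `SU(2)` Yang–Mills on `T³` — NOT `d = 4`, NOT infinite volume, NOT a mass gap, NOT Clay); width seat
`ym-ust-20520-w5` g15; helper of the crux `stmt-QuantumFields-20520` (`--supports … --as helper`, NOT a proof of it, and NOT a refutation of any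
stub by kernel).  Cheapest-falsifier lane on the organ row DET-REP-B `stub_detRepB` of `Cruxes/FluctuationComparisonRegPrIntL/Lines/semiclassical_s2beta.lean`
(v11 ∕ v11.1 ∕ v11.2; `def ProductRows` l.822 byte-identical in all three).

WHAT.  `ProductRows M₀ M₁ M₀′ M₁′ dist d d′ R α ε δ β₀ η θ θ₂ Sd Sdist B` asks, on `s ∈ [0,1]`, for the rows of
✓`Literature.Analysis.Matrix.abs_fourPt_log_det_le_of_productRows_of_subset` (px19 g10, p747248): column profile `hD` of `M₁′`, row profile `hE` of
`M₁ − M₀`, Combes–Thomas row `hA` on `M₁⁻¹`, entry bound `hB0` on `M₀⁻¹`, local sums `hSd hSdi`, ℓ¹ mixed response `hR` on `M₁′ − M₀′`, and the TWO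
CONSTRAINTS `α·ε·β₀·δ·Sd·Sdist ≤ B`, `β₀·η ≤ B·e^{−(θ−θ₂)R}`; in DET-REP-B `B := Cst·θBal_J²` with `Cst, θ, θ₂` UNIFORM (chosen before the family, the coupling,
the run `K` and the height `J`), while the eleven letters are free PER QUADRILATERAL.  This file ELIMINATES the eleven letters: whatever they are, the rows and the
two constraints imply, for the matrices themselves (all sums over the WHOLE index type `Fin dV`),
* §1 (K1) `1 ≤ β₀·Σ_b |M₀ a b|` and (K2) `1 ≤ α·Sdist·Σ_b |M₁ a b|` for EVERY index `a` (from `(M·M⁻¹) a a = 1`) — so `α`, `β₀` can never be smaller than the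
  reciprocal of ONE row norm (correction to the power count of `LOCATE-DETREP-DEPTH-SCALING-px19g10.md` §3, which books `α, β₀ ≍ L^{−(K−J)}`);
  (K3) `Σ_a Σ_x |M₁′ x a| ≤ δ·Sd`, (K3′) `Σ_c |(M₁ − M₀) b c| ≤ ε`;
* §2 ★★(T1) `Σ_a Σ_b |(M₁′ − M₀′) a b| ≤ B·e^{−(θ−θ₂)R} · Σ_b |M₀ a₁ b|` for every `a₁`, and
  ★★(T2) `(Σ_a Σ_x |M₁′ x a|) · (Σ_c |(M₁ − M₀) b₁ c|) ≤ B · (Σ_b |M₁ a₀ b|) · (Σ_b |M₀ a₁ b|)` for every `a₀ a₁ b₁` —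
  the ENTRYWISE ℓ¹ MASS of the edge-response of the slice Hessian over ALL tube coordinates (an EXTENSIVE quantity: `dV ≍ L^{3(K−J)}` coordinates per block of the
  height-`J` lattice) is bounded by `Cst·θBal_J²` times ONE OR TWO ROW NORMS (INTENSIVE quantities).  Both are invariant under rescaling the tube coordinates.
* §2♯ the sharp editions through the INVERSE: (K2♯) `Σ_b |(M₁ s)⁻¹ a b| ≤ α·Sdist`, (K5′) every eigenvalue `λ` of `M₁ s` has `1 ≤ |λ|·‖row_i (M₁ s)⁻¹‖₁` for some `i`;
  ★★(T1♯) `|(M₀ s)⁻¹ a₁ a₂| · Σ|M₁′ − M₀′| ≤ B·e^{−(θ−θ₂)R}`; ★★(T2♯) `‖row (M₁ s)⁻¹‖₁ · |(M₀ s)⁻¹ a₁ a₂| · Σ|M₁′| · row(M₁ − M₀) ≤ B`; ★★(T2♭) the same with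
  `‖row (M₁ s)⁻¹‖₁` replaced by `1∕|λ|` for ANY eigenvalue: `|(M₀ s)⁻¹ a₁ a₂| · Σ|M₁′| · row(M₁ − M₀) ≤ B·|λ_min(M₁ s)|` — the block-constrained fluctuation GAP of the
  slice Hessian (`≍ L^{−2(K−J)}` relative to its entries: the Poincaré scale that GAP♯ bounds from below) multiplies the uniform constant.
* §3 (K4) `fourPt_sum_eq_zero_of_blind` ∕ `fourPt_sum_eq_zero_of_support`: a functional of the window datum that is a SUM OF LOCAL TERMS none of which sees both
  moved bonds `b`, `b′` has mixed four-point `(f U − f V) − (f W − f Z) = 0` on every window quadrilateral — the reason FOUR-POINT-DECAY can hold with a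
  depth-uniform constant although no entrywise row can: the depth-divergent parts of `log det M` (tadpole ∕ bubble, UV-linear in `d = 3`, cancelling by gauge
  invariance) are LOCAL in the datum and drop out of `Δ²`.

WHY IT MATTERS (memo `ym-ust-20520-w5/g15/FINDING-w5g15-DETREPB-DEPTH.md`, heuristic power count, labelled so): in a FIXED tube frame the relative per-entry
response of `hessStd (A ∘ c.Φ(x ·, σ ·)) y` to a one-bond move of the datum is connection-level `≍ θ_J·L^{−(K−J)}`, spread over `≍ L^{3(K−J)}` coordinates, so the
left sides of (T1)∕(T2) are `≍ L^{(1…2)(K−J)}·θ_J²` times the right sides: a UNIFORM `Cst` is then impossible — DET-REP-B's (LOC) currency is suspected not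
depth-uniformly satisfiable for the named matrices (to be settled by an instrument row measuring `Σ|∂M| ∕ ‖row M‖` at depth 1–3).  Nothing here proves or
refutes that; the file only turns the question into these two scalar magnitudes.

HONEST SCOPE.  Finite-dimensional real matrix algebra and one cancellation identity; def-free; default heartbeats; proves nothing of DET-REP-B ∕ FOUR-POINT-DECAY ∕
S2β ∕ the crux 20520; `YM3TorusSU2` NOT proved; the Yang–Mills mass gap (Clay) NOT proved.
References: [Balaban1985Variational] CMP 102 (1985) 277, Thm 1 (9)–(10) p. 279 (background response); [Balaban1984PropagatorsII] CMP 96 (1984) 223, (1.33)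
(coarse-unit decay of the inverse fluctuation operator); [HornJohnson2013] §0.7, §5.6 (inverse identities, absolute row sums); [GlimmJaffe1987] §18.2.
-/

noncomputable section

open Finset Set
open scoped Matrix

namespace Summit.QuantumFields.YangMills.Theorems.FluctuationComparisonRegPrIntLS2BetaProductRowsTightness

variable {n : Type*} [Fintype n] [DecidableEq n]

/-! ## §1 The four eliminations (one matrix at a time) -/

/-- (K1) **An entry bound on `M⁻¹` is at least the reciprocal of every row norm of `M`.**  If `det M` is a unit and `|M⁻¹ b a| ≤ β` for all `b` (one column of
the inverse), then `1 ≤ β · Σ_b |M a b|`: read the `(a,a)` entry of `M·M⁻¹ = 1`. [cite: HornJohnson2013, §0.7 (inverse) and §5.6 (absolute row sums)] -/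
theorem one_le_mul_rowSum_of_inv_col_le {M : Matrix n n ℝ} (hM : IsUnit M.det) {β : ℝ} (a : n)
    (hB : ∀ b, |M⁻¹ b a| ≤ β) : 1 ≤ β * ∑ b, |M a b| := by
  have h1 : (1 : ℝ) = ∑ b, M a b * M⁻¹ b a := by
    have h := congrArg (fun N : Matrix n n ℝ => N a a) (Matrix.mul_nonsing_inv M hM)
    simp only [Matrix.mul_apply, Matrix.one_apply_eq] at h
    exact h.symm
  calc (1 : ℝ) = ∑ b, M a b * M⁻¹ b a := h1
    _ ≤ ∑ b, |M a b * M⁻¹ b a| := by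
        refine (le_abs_self _).trans ?_
        exact abs_sum_le_sum_abs _ _
    _ = ∑ b, |M a b| * |M⁻¹ b a| := by simp_rw [abs_mul]
    _ ≤ ∑ b, |M a b| * β := by
        refine sum_le_sum fun b _ => ?_
        exact mul_le_mul_of_nonneg_left (hB b) (abs_nonneg _)
    _ = β * ∑ b, |M a b| := by rw [← sum_mul, mul_comm]

/-- (K2) **A Combes–Thomas row on `M⁻¹` and the local-sum row force `1 ≤ α·Sdist·Σ_b |M a b|` for every `a`.**  From `|M⁻¹ b a| ≤ α·e^{−θ·dist b a}`,
`θ₂ ≤ θ`, `0 ≤ α`, and `Σ_{b′} e^{−θ₂·dist b b′} ≤ Sdist` (used only through its term `b′ = a`): `|M⁻¹ b a| ≤ α·Sdist`, then (K1).  Note that NO pseudo-metric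
axiom on `dist` is used (in particular not `dist a a = 0`). [cite: HornJohnson2013, §0.7 and §5.6] -/
theorem one_le_mul_mul_rowSum_of_inv_le_exp {M : Matrix n n ℝ} (hM : IsUnit M.det) (dist : n → n → ℕ) {α θ θ₂ Sdist : ℝ}
    (hα : 0 ≤ α) (hθ₂θ : θ₂ ≤ θ) (a : n)
    (hA : ∀ b, |M⁻¹ b a| ≤ α * Real.exp (-(θ * dist b a)))
    (hSdi : ∀ b, ∑ b', Real.exp (-(θ₂ * dist b b')) ≤ Sdist) : 1 ≤ α * Sdist * ∑ b, |M a b| := by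
  refine one_le_mul_rowSum_of_inv_col_le hM a fun b => (hA b).trans ?_
  have hd : (0 : ℝ) ≤ dist b a := Nat.cast_nonneg _
  have h1 : Real.exp (-(θ * dist b a)) ≤ Real.exp (-(θ₂ * dist b a)) :=
    Real.exp_le_exp.mpr (by nlinarith)
  have h2 : Real.exp (-(θ₂ * dist b a)) ≤ Sdist :=
    (single_le_sum (f := fun b' => Real.exp (-(θ₂ * dist b b'))) (fun b' _ => (Real.exp_pos _).le) (mem_univ a)).trans (hSdi b)
  exact mul_le_mul_of_nonneg_left (h1.trans h2) hα

omit [DecidableEq n] in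
/-- (K3) **A column profile and its local sum bound the TOTAL entrywise ℓ¹ mass.**  `Σ_x |D x a| ≤ δ·e^{−θ·d a}` for all `a`, `θ₂ ≤ θ`, `0 ≤ δ`,
`Σ_a e^{−θ₂·d a} ≤ Sd` ⟹ `Σ_a Σ_x |D x a| ≤ δ·Sd`. [cite: HornJohnson2013, §5.6] -/
theorem sum_sum_abs_le_of_colProfile {D : Matrix n n ℝ} {δ θ θ₂ Sd : ℝ} {d : n → ℕ} (hδ : 0 ≤ δ) (hθ₂θ : θ₂ ≤ θ)
    (hD : ∀ a, ∑ x, |D x a| ≤ δ * Real.exp (-(θ * d a))) (hSd : ∑ a, Real.exp (-(θ₂ * d a)) ≤ Sd) :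
    ∑ a, ∑ x, |D x a| ≤ δ * Sd := by
  calc ∑ a, ∑ x, |D x a| ≤ ∑ a, δ * Real.exp (-(θ₂ * d a)) := by
        refine sum_le_sum fun a _ => (hD a).trans ?_
        have hd : (0 : ℝ) ≤ d a := Nat.cast_nonneg _
        exact mul_le_mul_of_nonneg_left (Real.exp_le_exp.mpr (by nlinarith)) hδ
    _ = δ * ∑ a, Real.exp (-(θ₂ * d a)) := by rw [mul_sum]
    _ ≤ δ * Sd := mul_le_mul_of_nonneg_left hSd hδ

omit [DecidableEq n] in
/-- (K3′) **A row profile bounds the row.**  `Σ_c |E b c| ≤ ε·e^{−θ·d′ b}`, `0 ≤ θ`, `0 ≤ ε` ⟹ `Σ_c |E b c| ≤ ε`. [cite: HornJohnson2013, §5.6] -/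
theorem rowSum_le_of_rowProfile {E : Matrix n n ℝ} {ε θ : ℝ} {d' : n → ℕ} (hε : 0 ≤ ε) (hθ : 0 ≤ θ)
    (hE : ∀ b, ∑ c, |E b c| ≤ ε * Real.exp (-(θ * d' b))) (b : n) : ∑ c, |E b c| ≤ ε := by
  refine (hE b).trans ?_
  have hd : (0 : ℝ) ≤ d' b := Nat.cast_nonneg _
  have h1 : Real.exp (-(θ * d' b)) ≤ 1 := Real.exp_le_one_iff.mpr (by nlinarith)
  simpa using mul_le_mul_of_nonneg_left h1 hε

/-! ## §2 What the (LOC) letters of DET-REP-B force (the letters `α ε δ β₀ η Sd Sdist dist d d′` eliminated)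

The hypotheses below are the conjuncts of `ProductRows M₀ M₁ M₀′ M₁′ dist d d′ R α ε δ β₀ η θ θ₂ Sd Sdist B` (line file l.822) that each statement uses,
VERBATIM (rows on `s ∈ Icc 0 1`), plus `0 ≤ θ₂`, `θ₂ < θ` from `DetRepB`'s prefix (only `θ₂ ≤ θ` is used) and the invertibility that ✓`detRepA_edge`'s (DET) row
supplies for the named matrices.  A delta certificate in the seat's HOME directory instantiates them from the `def ProductRows` of the tree file. -/

/-- ★★ (T1) **THE MIXED-RESPONSE CONSTRAINT FORCES AN EXTENSIVE-BY-INTENSIVE BOUND.**  From `hB0 : |(M₀ s)⁻¹ a b| ≤ β₀`, `hR : Σ_aΣ_b |(M₁′ s − M₀′ s) a b| ≤ η`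
and `β₀·η ≤ B·e^{−(θ−θ₂)R}`: for every `s ∈ [0,1]` with `det (M₀ s)` a unit and EVERY index `a₁`,
`Σ_a Σ_b |(M₁′ s − M₀′ s) a b| ≤ B·e^{−(θ−θ₂)R} · Σ_b |M₀ s a₁ b|` — the total ℓ¹ mass of the mixed second response of the slice Hessian (sum over ALL entries) is at
most the uniform `B = Cst·θBal_J²`, the decay factor, and ONE row norm of `M₀ s`. [cite: Balaban1985Variational, Thm 1 (9)-(10) p. 279] [cite: HornJohnson2013, §0.7 and §5.6] -/
theorem mixedResponse_l1_le_of_rows {M₀ M₀' M₁' : ℝ → Matrix n n ℝ} {β₀ η θ θ₂ B : ℝ} {R : ℕ}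
    (hB0 : ∀ s ∈ Icc (0 : ℝ) 1, ∀ a b, |(M₀ s)⁻¹ a b| ≤ β₀)
    (hR : ∀ s ∈ Icc (0 : ℝ) 1, ∑ a, ∑ b, |(M₁' s - M₀' s) a b| ≤ η)
    (hmix : β₀ * η ≤ B * Real.exp (-((θ - θ₂) * R)))
    {s : ℝ} (hs : s ∈ Icc (0 : ℝ) 1) (hdet : IsUnit (M₀ s).det) (a₁ : n) :
    ∑ a, ∑ b, |(M₁' s - M₀' s) a b| ≤ B * Real.exp (-((θ - θ₂) * R)) * ∑ b, |M₀ s a₁ b| := by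
  set r := ∑ b, |M₀ s a₁ b| with hr
  have hr0 : 0 ≤ r := sum_nonneg fun b _ => abs_nonneg _
  have h1 : 1 ≤ β₀ * r := one_le_mul_rowSum_of_inv_col_le hdet a₁ fun b => hB0 s hs b a₁
  have hη : 0 ≤ η := (sum_nonneg fun a _ => sum_nonneg fun b _ => abs_nonneg _).trans (hR s hs)
  calc ∑ a, ∑ b, |(M₁' s - M₀' s) a b| ≤ η := hR s hs
    _ = η * 1 := (mul_one η).symm
    _ ≤ η * (β₀ * r) := mul_le_mul_of_nonneg_left h1 hη
    _ = (β₀ * η) * r := by ring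
    _ ≤ B * Real.exp (-((θ - θ₂) * R)) * r := mul_le_mul_of_nonneg_right hmix hr0

/-- ★★ (T2) **THE PRODUCT CONSTRAINT FORCES AN EXTENSIVE-BY-INTENSIVE BOUND.**  From the rows `hD hE hA hB0 hSd hSdi` and `α·ε·β₀·δ·Sd·Sdist ≤ B` (letters
`0 ≤ α, 0 ≤ ε, 0 ≤ δ`, rates `0 ≤ θ₂ ≤ θ`): for every `s ∈ [0,1]` at which `det (M₀ s)` and `det (M₁ s)` are units and ALL indices `a₀ a₁ b₁`,
`(Σ_a Σ_x |M₁′ s x a|) · (Σ_c |(M₁ s − M₀ s) b₁ c|) ≤ B · (Σ_b |M₁ s a₀ b|) · (Σ_b |M₀ s a₁ b|)` — (total ℓ¹ mass of the edge-derivative of the slice Hessian) ×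
(any one row of the two edges' Hessian difference) is at most `B = Cst·θBal_J²` times two row norms; no separation `R` and no letter survives.  Mechanism:
`δ·Sd ≥ Σ|M₁′|` (K3), `ε ≥ row` (K3′), `α·Sdist·row(M₁) ≥ 1` (K2), `β₀·row(M₀) ≥ 1` (K1).
[cite: Balaban1985Variational, Thm 1 (9)-(10) p. 279] [cite: Balaban1984PropagatorsII, (1.33)] [cite: HornJohnson2013, §0.7 and §5.6] -/
theorem response_l1_mul_diffRow_le_of_rows (dist : n → n → ℕ) {M₀ M₁ M₁' : ℝ → Matrix n n ℝ} {d d' : n → ℕ}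
    {α ε δ β₀ θ θ₂ Sd Sdist B : ℝ} (hα : 0 ≤ α) (hε : 0 ≤ ε) (hδ : 0 ≤ δ) (hθ₂ : 0 ≤ θ₂) (hθ₂θ : θ₂ ≤ θ)
    (hD : ∀ s ∈ Icc (0 : ℝ) 1, ∀ a, ∑ x, |M₁' s x a| ≤ δ * Real.exp (-(θ * d a)))
    (hE : ∀ s ∈ Icc (0 : ℝ) 1, ∀ b, ∑ c, |(M₁ s - M₀ s) b c| ≤ ε * Real.exp (-(θ * d' b)))
    (hA : ∀ s ∈ Icc (0 : ℝ) 1, ∀ a b, |(M₁ s)⁻¹ a b| ≤ α * Real.exp (-(θ * dist a b)))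
    (hB0 : ∀ s ∈ Icc (0 : ℝ) 1, ∀ a b, |(M₀ s)⁻¹ a b| ≤ β₀)
    (hSd : ∑ a, Real.exp (-(θ₂ * d a)) ≤ Sd) (hSdi : ∀ a, ∑ b, Real.exp (-(θ₂ * dist a b)) ≤ Sdist)
    (hprod : α * ε * β₀ * δ * Sd * Sdist ≤ B)
    {s : ℝ} (hs : s ∈ Icc (0 : ℝ) 1) (hdet₀ : IsUnit (M₀ s).det) (hdet₁ : IsUnit (M₁ s).det) (a₀ a₁ b₁ : n) :
    (∑ a, ∑ x, |M₁' s x a|) * (∑ c, |(M₁ s - M₀ s) b₁ c|) ≤ B * (∑ b, |M₁ s a₀ b|) * (∑ b, |M₀ s a₁ b|) := by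
  set D₁ := ∑ a, ∑ x, |M₁' s x a| with hD₁
  set E₁ := ∑ c, |(M₁ s - M₀ s) b₁ c| with hE₁
  set r₁ := ∑ b, |M₁ s a₀ b| with hr₁
  set r₀ := ∑ b, |M₀ s a₁ b| with hr₀
  have hD₁0 : 0 ≤ D₁ := sum_nonneg fun a _ => sum_nonneg fun x _ => abs_nonneg _
  have hE₁0 : 0 ≤ E₁ := sum_nonneg fun c _ => abs_nonneg _
  have hr₁0 : 0 ≤ r₁ := sum_nonneg fun b _ => abs_nonneg _
  have hr₀0 : 0 ≤ r₀ := sum_nonneg fun b _ => abs_nonneg _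
  -- the four eliminations
  have hK3 : D₁ ≤ δ * Sd := sum_sum_abs_le_of_colProfile hδ hθ₂θ (hD s hs) hSd
  have hK3' : E₁ ≤ ε := rowSum_le_of_rowProfile hε (hθ₂.trans hθ₂θ) (hE s hs) b₁
  have hK2 : 1 ≤ α * Sdist * r₁ :=
    one_le_mul_mul_rowSum_of_inv_le_exp hdet₁ dist hα hθ₂θ a₀ (fun b => hA s hs b a₀) (fun b => hSdi b)
  have hK1 : 1 ≤ β₀ * r₀ := one_le_mul_rowSum_of_inv_col_le hdet₀ a₁ fun b => hB0 s hs b a₁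
  have hδSd : 0 ≤ δ * Sd := hD₁0.trans hK3
  -- assemble
  have h1 : D₁ * E₁ ≤ (δ * Sd) * ε := mul_le_mul hK3 hK3' hE₁0 hδSd
  have h2 : (δ * Sd) * ε ≤ (δ * Sd) * ε * (α * Sdist * r₁) :=
    le_mul_of_one_le_right (mul_nonneg hδSd hε) hK2
  have h3 : (δ * Sd) * ε * (α * Sdist * r₁) ≤ (δ * Sd) * ε * (α * Sdist * r₁) * (β₀ * r₀) :=
    le_mul_of_one_le_right (mul_nonneg (mul_nonneg hδSd hε) (zero_le_one.trans hK2)) hK1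
  have h4 : (δ * Sd) * ε * (α * Sdist * r₁) * (β₀ * r₀) = (α * ε * β₀ * δ * Sd * Sdist) * (r₁ * r₀) := by ring
  calc D₁ * E₁ ≤ (δ * Sd) * ε * (α * Sdist * r₁) * (β₀ * r₀) := h1.trans (h2.trans h3)
    _ = (α * ε * β₀ * δ * Sd * Sdist) * (r₁ * r₀) := h4
    _ ≤ B * (r₁ * r₀) := mul_le_mul_of_nonneg_right hprod (mul_nonneg hr₁0 hr₀0)
    _ = B * r₁ * r₀ := by ring

/-- ★ (T3) **THE COMBES–THOMAS LETTER AND THE INVERSE BOUND ARE PINNED BELOW BY ROW NORMS** (the correction to the `α, β₀ ≍ L^{−(K−J)}` count): under the rows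
`hA hSdi hB0` of `ProductRows`, at every `s ∈ [0,1]` where the named matrices are invertible, `1 ≤ α·Sdist·Σ_b |M₁ s a b|` and `1 ≤ β₀·Σ_b |M₀ s a b|` for EVERY
index `a`. [cite: Balaban1984PropagatorsII, (1.33)] [cite: HornJohnson2013, §0.7 and §5.6] -/
theorem one_le_letters_mul_rowSum_of_rows (dist : n → n → ℕ) {M₀ M₁ : ℝ → Matrix n n ℝ} {α β₀ θ θ₂ Sdist : ℝ}
    (hα : 0 ≤ α) (hθ₂θ : θ₂ ≤ θ)
    (hA : ∀ s ∈ Icc (0 : ℝ) 1, ∀ a b, |(M₁ s)⁻¹ a b| ≤ α * Real.exp (-(θ * dist a b)))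
    (hB0 : ∀ s ∈ Icc (0 : ℝ) 1, ∀ a b, |(M₀ s)⁻¹ a b| ≤ β₀)
    (hSdi : ∀ a, ∑ b, Real.exp (-(θ₂ * dist a b)) ≤ Sdist)
    {s : ℝ} (hs : s ∈ Icc (0 : ℝ) 1) (hdet₀ : IsUnit (M₀ s).det) (hdet₁ : IsUnit (M₁ s).det) (a : n) :
    1 ≤ α * Sdist * ∑ b, |M₁ s a b| ∧ 1 ≤ β₀ * ∑ b, |M₀ s a b| :=
  ⟨one_le_mul_mul_rowSum_of_inv_le_exp hdet₁ dist hα hθ₂θ a (fun b => hA s hs b a) (fun b => hSdi b),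
    one_le_mul_rowSum_of_inv_col_le hdet₀ a fun b => hB0 s hs b a⟩

/-! ## §2♯ The sharp editions: the letters are pinned by the INVERSE (Green's function) — row sums of `M₁⁻¹`, entries of `M₀⁻¹`, eigenvalues of `M₁` -/

omit [DecidableEq n] in
/-- (K5) **An eigenvalue relation read at the largest coordinate.**  If `v ≠ 0` and `v = λ • (G *ᵥ v)` then some row of `G` has `1 ≤ |λ|·Σ_j |G i j|`
(take `i` with `|v i|` maximal).  Used with `G := M⁻¹`: every eigenvalue `λ` of an invertible `M` satisfies `1 ≤ |λ|·‖row_i M⁻¹‖₁` for some `i`, i.e. the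
maximal absolute row sum of `M⁻¹` is at least `1∕|λ_min|`. [cite: HornJohnson2013, §5.6 (the maximum row sum norm dominates the spectral radius)] -/
theorem exists_one_le_abs_mul_rowSum_of_eq_smul_mulVec {G : Matrix n n ℝ} {v : n → ℝ} {lam : ℝ} (hv : v ≠ 0)
    (h : v = lam • (G *ᵥ v)) : ∃ i, 1 ≤ |lam| * ∑ j, |G i j| := by
  classical
  obtain ⟨j₀, hj₀⟩ := Function.ne_iff.mp hv
  obtain ⟨i, -, hi⟩ := exists_max_image (univ : Finset n) (fun j => |v j|) ⟨j₀, mem_univ j₀⟩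
  have hvi : 0 < |v i| := (abs_pos.mpr hj₀).trans_le (hi j₀ (mem_univ j₀))
  refine ⟨i, ?_⟩
  have h1 : v i = lam * ∑ j, G i j * v j := by
    have := congrFun h i
    simpa [Pi.smul_apply, Matrix.mulVec, dotProduct, smul_eq_mul] using this
  have h2 : 1 * |v i| ≤ |lam| * (∑ j, |G i j|) * |v i| := by
    calc 1 * |v i| = |lam| * |∑ j, G i j * v j| := by rw [one_mul, h1, abs_mul]
      _ ≤ |lam| * ∑ j, |G i j * v j| := mul_le_mul_of_nonneg_left (abs_sum_le_sum_abs _ _) (abs_nonneg _)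
      _ = |lam| * ∑ j, |G i j| * |v j| := by simp_rw [abs_mul]
      _ ≤ |lam| * ∑ j, |G i j| * |v i| :=
          mul_le_mul_of_nonneg_left (sum_le_sum fun j _ => mul_le_mul_of_nonneg_left (hi j (mem_univ j)) (abs_nonneg _)) (abs_nonneg _)
      _ = |lam| * (∑ j, |G i j|) * |v i| := by rw [← sum_mul]; ring
  exact le_of_mul_le_mul_right h2 hvi

/-- (K5′) **Every eigenvalue of an invertible matrix is at least the reciprocal of the maximal row sum of the inverse**: `M *ᵥ v = λ • v`, `v ≠ 0`, `det M` a unit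
⟹ `∃ i, 1 ≤ |λ|·Σ_j |M⁻¹ i j|`. [cite: HornJohnson2013, §5.6] -/
theorem exists_one_le_abs_eigenvalue_mul_rowSum_inv {M : Matrix n n ℝ} (hM : IsUnit M.det) {v : n → ℝ} {lam : ℝ} (hv : v ≠ 0)
    (h : M *ᵥ v = lam • v) : ∃ i, 1 ≤ |lam| * ∑ j, |M⁻¹ i j| := by
  refine exists_one_le_abs_mul_rowSum_of_eq_smul_mulVec hv ?_
  calc v = M⁻¹ *ᵥ (M *ᵥ v) := by rw [Matrix.mulVec_mulVec, Matrix.nonsing_inv_mul M hM, Matrix.one_mulVec]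
    _ = lam • (M⁻¹ *ᵥ v) := by rw [h, Matrix.mulVec_smul]

omit [DecidableEq n] in
/-- (K2♯) **The Combes–Thomas letter times the local sum dominates every absolute ROW SUM of the inverse.**  `|G a b| ≤ α·e^{−θ·dist a b}`, `0 ≤ α`, `θ₂ ≤ θ`,
`Σ_b e^{−θ₂·dist a b} ≤ Sdist` ⟹ `Σ_b |G a b| ≤ α·Sdist`.  (With `G := (M₁ s)⁻¹`: the `ℓ^∞ → ℓ^∞` norm of the inverse slice Hessian — at least `1∕λ_min` by
(K5′) — is at most `α·Sdist`.) [cite: Balaban1984PropagatorsII, (1.33)] [cite: HornJohnson2013, §5.6] -/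
theorem rowSum_le_of_entry_le_exp {G : Matrix n n ℝ} (dist : n → n → ℕ) {α θ θ₂ Sdist : ℝ} (hα : 0 ≤ α) (hθ₂θ : θ₂ ≤ θ) (a : n)
    (hA : ∀ b, |G a b| ≤ α * Real.exp (-(θ * dist a b))) (hSdi : ∑ b, Real.exp (-(θ₂ * dist a b)) ≤ Sdist) :
    ∑ b, |G a b| ≤ α * Sdist := by
  calc ∑ b, |G a b| ≤ ∑ b, α * Real.exp (-(θ₂ * dist a b)) := by
        refine sum_le_sum fun b _ => (hA b).trans ?_
        have hd : (0 : ℝ) ≤ dist a b := Nat.cast_nonneg _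
        exact mul_le_mul_of_nonneg_left (Real.exp_le_exp.mpr (by nlinarith)) hα
    _ = α * ∑ b, Real.exp (-(θ₂ * dist a b)) := by rw [mul_sum]
    _ ≤ α * Sdist := mul_le_mul_of_nonneg_left hSdi hα

/-- ★★ (T1♯) **MIXED RESPONSE × ANY ENTRY OF THE INVERSE ≤ `B·e^{−(θ−θ₂)R}`.**  From `hB0`, `hR`, `β₀·η ≤ B·e^{−(θ−θ₂)R}`: for every `s ∈ [0,1]` and indices `a₁ a₂`,
`|(M₀ s)⁻¹ a₁ a₂| · Σ_aΣ_b |(M₁′ s − M₀′ s) a b| ≤ B·e^{−(θ−θ₂)R}` — no invertibility needed.  (Reading: the coincidence value of the Green's function of the slice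
Hessian times the total ℓ¹ mass of the mixed second response — the «tadpole» insertion — is bounded by the uniform `Cst·θBal_J²`.)
[cite: Balaban1985Variational, Thm 1 (9)-(10) p. 279] [cite: GlimmJaffe1987, §18.2] -/
theorem invEntry_mul_mixedResponse_l1_le_of_rows {M₀ M₀' M₁' : ℝ → Matrix n n ℝ} {β₀ η θ θ₂ B : ℝ} {R : ℕ}
    (hB0 : ∀ s ∈ Icc (0 : ℝ) 1, ∀ a b, |(M₀ s)⁻¹ a b| ≤ β₀)
    (hR : ∀ s ∈ Icc (0 : ℝ) 1, ∑ a, ∑ b, |(M₁' s - M₀' s) a b| ≤ η)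
    (hmix : β₀ * η ≤ B * Real.exp (-((θ - θ₂) * R)))
    {s : ℝ} (hs : s ∈ Icc (0 : ℝ) 1) (a₁ a₂ : n) :
    |(M₀ s)⁻¹ a₁ a₂| * ∑ a, ∑ b, |(M₁' s - M₀' s) a b| ≤ B * Real.exp (-((θ - θ₂) * R)) := by
  have hH0 : 0 ≤ ∑ a, ∑ b, |(M₁' s - M₀' s) a b| := sum_nonneg fun a _ => sum_nonneg fun b _ => abs_nonneg _
  have hβ₀ : 0 ≤ β₀ := (abs_nonneg _).trans (hB0 s hs a₁ a₂)
  calc |(M₀ s)⁻¹ a₁ a₂| * ∑ a, ∑ b, |(M₁' s - M₀' s) a b| ≤ β₀ * η := mul_le_mul (hB0 s hs a₁ a₂) (hR s hs) hH0 hβ₀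
    _ ≤ B * Real.exp (-((θ - θ₂) * R)) := hmix

/-- ★★ (T2♯) **ROW SUM OF `M₁⁻¹` × ENTRY OF `M₀⁻¹` × ℓ¹ RESPONSE × DIFFERENCE ROW ≤ `B`.**  From `hD hE hA hB0 hSd hSdi` and `α·ε·β₀·δ·Sd·Sdist ≤ B`: for every
`s ∈ [0,1]` and indices `a₀ a₁ a₂ b₁`, `(Σ_b |(M₁ s)⁻¹ a₀ b|) · |(M₀ s)⁻¹ a₁ a₂| · (Σ_aΣ_x |M₁′ s x a|) · (Σ_c |(M₁ s − M₀ s) b₁ c|) ≤ B` — no invertibility needed.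
With (K5′) the first factor may be replaced by `1∕|λ|` for any eigenvalue `λ` of `M₁ s` (next theorem): the INVERSE SPECTRAL GAP of the slice Hessian (`≍ L^{2(K−J)}`
relative to its entries, by the block Poincaré inequality that GAP♯ quantifies from below) enters the uniform product bound linearly.
[cite: Balaban1985Variational, Thm 1 (9)-(10) p. 279] [cite: Balaban1984PropagatorsII, (1.33)] [cite: GlimmJaffe1987, §18.2] -/
theorem invRow_mul_invEntry_mul_response_mul_diffRow_le_of_rows (dist : n → n → ℕ) {M₀ M₁ M₁' : ℝ → Matrix n n ℝ} {d d' : n → ℕ}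
    {α ε δ β₀ θ θ₂ Sd Sdist B : ℝ} (hα : 0 ≤ α) (hε : 0 ≤ ε) (hδ : 0 ≤ δ) (hθ₂ : 0 ≤ θ₂) (hθ₂θ : θ₂ ≤ θ)
    (hD : ∀ s ∈ Icc (0 : ℝ) 1, ∀ a, ∑ x, |M₁' s x a| ≤ δ * Real.exp (-(θ * d a)))
    (hE : ∀ s ∈ Icc (0 : ℝ) 1, ∀ b, ∑ c, |(M₁ s - M₀ s) b c| ≤ ε * Real.exp (-(θ * d' b)))
    (hA : ∀ s ∈ Icc (0 : ℝ) 1, ∀ a b, |(M₁ s)⁻¹ a b| ≤ α * Real.exp (-(θ * dist a b)))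
    (hB0 : ∀ s ∈ Icc (0 : ℝ) 1, ∀ a b, |(M₀ s)⁻¹ a b| ≤ β₀)
    (hSd : ∑ a, Real.exp (-(θ₂ * d a)) ≤ Sd) (hSdi : ∀ a, ∑ b, Real.exp (-(θ₂ * dist a b)) ≤ Sdist)
    (hprod : α * ε * β₀ * δ * Sd * Sdist ≤ B)
    {s : ℝ} (hs : s ∈ Icc (0 : ℝ) 1) (a₀ a₁ a₂ b₁ : n) :
    (∑ b, |(M₁ s)⁻¹ a₀ b|) * |(M₀ s)⁻¹ a₁ a₂| * (∑ a, ∑ x, |M₁' s x a|) * (∑ c, |(M₁ s - M₀ s) b₁ c|) ≤ B := by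
  set G₁ := ∑ b, |(M₁ s)⁻¹ a₀ b| with hG₁
  set g₀ := |(M₀ s)⁻¹ a₁ a₂| with hg₀
  set D₁ := ∑ a, ∑ x, |M₁' s x a| with hD₁
  set E₁ := ∑ c, |(M₁ s - M₀ s) b₁ c| with hE₁
  have hG₁0 : 0 ≤ G₁ := sum_nonneg fun b _ => abs_nonneg _
  have hg₀0 : 0 ≤ g₀ := abs_nonneg _
  have hD₁0 : 0 ≤ D₁ := sum_nonneg fun a _ => sum_nonneg fun x _ => abs_nonneg _
  have hE₁0 : 0 ≤ E₁ := sum_nonneg fun c _ => abs_nonneg _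
  have h1 : G₁ ≤ α * Sdist := rowSum_le_of_entry_le_exp dist hα hθ₂θ a₀ (fun b => hA s hs a₀ b) (hSdi a₀)
  have h2 : g₀ ≤ β₀ := hB0 s hs a₁ a₂
  have h3 : D₁ ≤ δ * Sd := sum_sum_abs_le_of_colProfile hδ hθ₂θ (hD s hs) hSd
  have h4 : E₁ ≤ ε := rowSum_le_of_rowProfile hε (hθ₂.trans hθ₂θ) (hE s hs) b₁
  have h12 : G₁ * g₀ ≤ (α * Sdist) * β₀ := mul_le_mul h1 h2 hg₀0 (hG₁0.trans h1)
  have h123 : G₁ * g₀ * D₁ ≤ (α * Sdist) * β₀ * (δ * Sd) :=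
    mul_le_mul h12 h3 hD₁0 (mul_nonneg (hG₁0.trans h1) ((hg₀0).trans h2))
  have h1234 : G₁ * g₀ * D₁ * E₁ ≤ (α * Sdist) * β₀ * (δ * Sd) * ε :=
    mul_le_mul h123 h4 hE₁0 (mul_nonneg (mul_nonneg (hG₁0.trans h1) (hg₀0.trans h2)) (hD₁0.trans h3))
  calc G₁ * g₀ * D₁ * E₁ ≤ (α * Sdist) * β₀ * (δ * Sd) * ε := h1234
    _ = α * ε * β₀ * δ * Sd * Sdist := by ring
    _ ≤ B := hprod

/-- ★★ (T2♭) **THE EIGENVALUE EDITION.**  Under the same rows: for every `s ∈ [0,1]` with `det (M₁ s)` a unit and every eigenpair `M₁ s *ᵥ v = λ • v`, `v ≠ 0`,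
`|(M₀ s)⁻¹ a₁ a₂| · (Σ_aΣ_x |M₁′ s x a|) · (Σ_c |(M₁ s − M₀ s) b₁ c|) ≤ B · |λ|` — in particular with `λ = λ_min (M₁ s)`: the smallest eigenvalue of the slice
Hessian (the block-constrained fluctuation gap, `≍ μ·L^{−2(K−J)}` in the frame's units) multiplies the uniform `B = Cst·θBal_J²`.
[cite: Balaban1985Variational, Thm 1 (9)-(10) p. 279 and (142) p. 299] [cite: Balaban1984PropagatorsII, (1.33)] [cite: HornJohnson2013, §5.6] -/
theorem invEntry_mul_response_mul_diffRow_le_mul_abs_eigenvalue_of_rows (dist : n → n → ℕ) {M₀ M₁ M₁' : ℝ → Matrix n n ℝ} {d d' : n → ℕ}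
    {α ε δ β₀ θ θ₂ Sd Sdist B : ℝ} (hα : 0 ≤ α) (hε : 0 ≤ ε) (hδ : 0 ≤ δ) (hθ₂ : 0 ≤ θ₂) (hθ₂θ : θ₂ ≤ θ)
    (hD : ∀ s ∈ Icc (0 : ℝ) 1, ∀ a, ∑ x, |M₁' s x a| ≤ δ * Real.exp (-(θ * d a)))
    (hE : ∀ s ∈ Icc (0 : ℝ) 1, ∀ b, ∑ c, |(M₁ s - M₀ s) b c| ≤ ε * Real.exp (-(θ * d' b)))
    (hA : ∀ s ∈ Icc (0 : ℝ) 1, ∀ a b, |(M₁ s)⁻¹ a b| ≤ α * Real.exp (-(θ * dist a b)))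
    (hB0 : ∀ s ∈ Icc (0 : ℝ) 1, ∀ a b, |(M₀ s)⁻¹ a b| ≤ β₀)
    (hSd : ∑ a, Real.exp (-(θ₂ * d a)) ≤ Sd) (hSdi : ∀ a, ∑ b, Real.exp (-(θ₂ * dist a b)) ≤ Sdist)
    (hprod : α * ε * β₀ * δ * Sd * Sdist ≤ B)
    {s : ℝ} (hs : s ∈ Icc (0 : ℝ) 1) (hdet₁ : IsUnit (M₁ s).det) {v : n → ℝ} {lam : ℝ} (hv : v ≠ 0) (heig : M₁ s *ᵥ v = lam • v)
    (a₁ a₂ b₁ : n) :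
    |(M₀ s)⁻¹ a₁ a₂| * (∑ a, ∑ x, |M₁' s x a|) * (∑ c, |(M₁ s - M₀ s) b₁ c|) ≤ B * |lam| := by
  obtain ⟨i, hi⟩ := exists_one_le_abs_eigenvalue_mul_rowSum_inv hdet₁ hv heig
  have hmain := invRow_mul_invEntry_mul_response_mul_diffRow_le_of_rows dist hα hε hδ hθ₂ hθ₂θ hD hE hA hB0 hSd hSdi hprod hs i a₁ a₂ b₁
  have hP0 : 0 ≤ |(M₀ s)⁻¹ a₁ a₂| * (∑ a, ∑ x, |M₁' s x a|) * (∑ c, |(M₁ s - M₀ s) b₁ c|) :=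
    mul_nonneg (mul_nonneg (abs_nonneg _) (sum_nonneg fun a _ => sum_nonneg fun x _ => abs_nonneg _))
      (sum_nonneg fun c _ => abs_nonneg _)
  calc |(M₀ s)⁻¹ a₁ a₂| * (∑ a, ∑ x, |M₁' s x a|) * (∑ c, |(M₁ s - M₀ s) b₁ c|)
      = 1 * (|(M₀ s)⁻¹ a₁ a₂| * (∑ a, ∑ x, |M₁' s x a|) * (∑ c, |(M₁ s - M₀ s) b₁ c|)) := (one_mul _).symm
    _ ≤ (|lam| * ∑ b, |(M₁ s)⁻¹ i b|) * (|(M₀ s)⁻¹ a₁ a₂| * (∑ a, ∑ x, |M₁' s x a|) * (∑ c, |(M₁ s - M₀ s) b₁ c|)) :=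
        mul_le_mul_of_nonneg_right hi hP0
    _ = |lam| * ((∑ b, |(M₁ s)⁻¹ i b|) * |(M₀ s)⁻¹ a₁ a₂| * (∑ a, ∑ x, |M₁' s x a|) * (∑ c, |(M₁ s - M₀ s) b₁ c|)) := by ring
    _ ≤ |lam| * B := mul_le_mul_of_nonneg_left hmain (abs_nonneg _)
    _ = B * |lam| := mul_comm _ _

/-! ## §3 Why the 4-point can still be depth-uniform: local functionals of the datum drop out of `Δ²` -/

/-- (K4) **A SUM OF TERMS EACH BLIND TO ONE OF THE TWO MOVES HAS VANISHING MIXED FOUR-POINT.**  For a quadrilateral `U V W Z` (edges `U→V`, `W→Z` = the `b`-move;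
`U→W`, `V→Z` = the `b′`-move) and `f = Σ_{p ∈ S} g p`: if every term satisfies `g p U = g p V ∧ g p W = g p Z` (blind to the `b`-move) or
`g p U = g p W ∧ g p V = g p Z` (blind to the `b′`-move), then `(f U − f V) − (f W − f Z) = 0`. [cite: GlimmJaffe1987, §18.2] -/
theorem fourPt_sum_eq_zero_of_blind {X ι : Type*} (S : Finset ι) (g : ι → X → ℝ) (U V W Z : X)
    (h : ∀ p ∈ S, (g p U = g p V ∧ g p W = g p Z) ∨ (g p U = g p W ∧ g p V = g p Z)) :
    (∑ p ∈ S, g p U - ∑ p ∈ S, g p V) - (∑ p ∈ S, g p W - ∑ p ∈ S, g p Z) = 0 := by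
  rw [← sum_sub_distrib, ← sum_sub_distrib, ← sum_sub_distrib]
  refine sum_eq_zero fun p hp => ?_
  rcases h p hp with ⟨h1, h2⟩ | ⟨h1, h2⟩
  · rw [h1, h2]; ring
  · rw [h1, h2]; ring

/-- (K4′) **LOCAL COUNTERTERMS OF THE DATUM HAVE ZERO FOUR-POINT ACROSS SEPARATED BONDS.**  Let `f U = Σ_{p ∈ S} g p U` where the term `g p` depends on the
bond variables `U e`, `e ∈ A p`, only (`hloc`), and suppose no term sees both moved bonds: `b ∉ A p ∨ b′ ∉ A p` for every `p ∈ S` (e.g. `g p` = a function of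
the plaquette `p` and `tdist(b, b′) ≥ 2`).  Then on every quadrilateral with the DET-REP-B agreement pattern (`U, V` differ only at `b`; `U, W` and `V, Z` only at
`b′`; `W, Z` only at `b`) the mixed four-point of `f` vanishes. [cite: GlimmJaffe1987, §18.2] [cite: Balaban1985UV3, (36)-(37) p. 265] -/
theorem fourPt_sum_eq_zero_of_support {Bd G ι : Type*} (S : Finset ι) (A : ι → Set Bd) (g : ι → (Bd → G) → ℝ)
    (hloc : ∀ p ∈ S, ∀ U U' : Bd → G, (∀ e ∈ A p, U e = U' e) → g p U = g p U')
    (b b' : Bd) (hsep : ∀ p ∈ S, b ∉ A p ∨ b' ∉ A p) (U V W Z : Bd → G)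
    (hUV : ∀ e, e ≠ b → U e = V e) (hUW : ∀ e, e ≠ b' → U e = W e) (hVZ : ∀ e, e ≠ b' → V e = Z e)
    (hWZ : ∀ e, e ≠ b → W e = Z e) :
    (∑ p ∈ S, g p U - ∑ p ∈ S, g p V) - (∑ p ∈ S, g p W - ∑ p ∈ S, g p Z) = 0 := by
  refine fourPt_sum_eq_zero_of_blind S g U V W Z fun p hp => ?_
  rcases hsep p hp with hb | hb'
  · refine Or.inl ⟨hloc p hp U V fun e he => hUV e ?_, hloc p hp W Z fun e he => hWZ e ?_⟩
    · rintro rfl; exact hb he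
    · rintro rfl; exact hb he
  · refine Or.inr ⟨hloc p hp U W fun e he => hUW e ?_, hloc p hp V Z fun e he => hVZ e ?_⟩
    · rintro rfl; exact hb' he
    · rintro rfl; exact hb' he

end Summit.QuantumFields.YangMills.Theorems.FluctuationComparisonRegPrIntLS2BetaProductRowsTightness

end
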